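/-
Copyright (c) 2026 the pub-hodgecm-mathlib formalisation cell (harness21).  Prover seat hodgecm-mathlib-K2E3-p07 (g0), Track B ∕ K2-LIT
(build stream 29), h413 = `stmt-HodgeConjecture-24833`, line `K2_E3_EllipticInputs`, socket module U4 «Keys», SIGS-TABLE-K2E3 row #7 — own-row helper
(dealer K2E3-plan (g1) DEALS BATCH #1: «provers with a GREEN-at-home first-rung helper: FILE it»): the LOWER bound matching ★ `K2E3IntertwinerSpaceDimLeOne`.  2026-09-03.
-/
import Summits.HodgeConjecture.HodgeConjecture.Theorems.K2E3IntertwinerSpaceDimLeOne              -- ★ p855215: socket #7 `intertwinerSpaceDimLeOne` (`dim Hom_G(i_G(χ), i_G(wχ)) ≤ 1`)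
import Summits.HodgeConjecture.HodgeConjecture.Theorems.F0P2pCmPrincipalSeriesInterface          -- ★ Frobenius, existence form: `exists_intertwiningMap_cmPrincipalSeries_ne_zero`, `isSmooth_cmPrincipalSeries`
import Summits.HodgeConjecture.HodgeConjecture.Theorems.F0P3U3PrincipalSeriesJacquetFiltrationHolds  -- ★ N1 `U3PrincipalSeriesJacquetFiltration_holds` [Casselman1995 L. 7.1.1 (a)]
import Summits.HodgeConjecture.HodgeConjecture.Theorems.F0P2pEigenlineFunctionals                -- ★ `exists_intertwiningMap_character_of_line` (projection onto the eigen-line)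
import Literature.NumberTheory.Automorphic.U3PrincipalSeriesJacquetFiltrationFullUnfold            -- ★ N1 ↔ its body (`U3PrincipalSeriesJacquetFiltration_iff`)
import Literature.NumberTheory.Automorphic.JacquetNonzeroEmbedsNormalizedInd                       -- ★ `UnitaryGroup.torusU_mul_comm` (the diagonal torus is commutative)
import HarnessLib

/-!
# h413 ∕ Track B «K2-LIT», line `K2_E3_EllipticInputs`, unit U4 «KEYS», row #7 (helper): `Hom_G(i_G(χ), i_G(wχ))` IS EXACTLY A LINE FOR REGULAR `χ`
# (the non-zero standard intertwiner EXISTS; with ★ socket #7 `intertwinerSpaceDimLeOne` it spans)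

Cell `pub/hodgecm-mathlib`, crux H413 = `stmt-HodgeConjecture-24833`, route of record `HCCMUnconditional`; chair K2-lead (g0), dealer K2E3-plan (g1).
THEOREMS ONLY (no `def`, no `instance`, no `notation`, no named-fact hypothesis, no `sorry`); lane `--supports stmt-HodgeConjecture-24833 --as helper`
(count-neutral: a U4 brick serving rows #4∕#5 — `sig_K2E3PSRegularReducibleCompZero` ∕ `sig_K2E3CompZeroKeysListRegular` identify «the» composition
`i_G(χ) → i_G(wχ) → i_G(χ)` with `γ(χ)·id`, which needs a NON-ZERO map `i_G(χ) → i_G(wχ)` to exist, not only uniqueness up to scalars).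

SETTING.  `L` CM, `v` a finite place of `L⁺` NON-SPLIT in `L`, `G = U(Φ₃)(L⁺_v)`, `B = TN` upper-triangular, `χ = (χ₁, χ₂)` continuous on `T ≅ L_v^× × E¹_v`
(★ `cmTorusCharPair L v χ₁ χ₂`), REGULAR: `χ ≠ wχ = (χ̄₁⁻¹, χ₂)` (★ `cmTorusCharPair L v (conjInvChar σ χ₁) χ₂`; `= cmWeylTorusCharPair L v χ₁ χ₂` by `rfl`).

THE MATHEMATICS ([Casselman1995, §6.4 Prop. 6.4.1 ∕ Thm. 6.4.1, L. 7.1.1 (a); Thm. 3.2.4]; [BernsteinZelevinsky1977, Prop. 1.9 (b), §2.12, Cor. 2.13 (c), Thm. 2.9];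
[Keys1984, §3]).  The normalised Jacquet module `X = r_B i_G(χ)` has a `T`-stable LINE `ℓ` on which `T` acts through `wχ` and modulo which through `χ`
(★ N1, hypothesis-free in the tree).  Since `T` is commutative (★ `torusU_mul_comm`) and `χ ≠ wχ`, the spectral projection onto `ℓ` along `r(m₀) − χ(m₀)`
is a NON-ZERO `T`-map `X → ℂ_{wχ}` (★ `F0P2pEigenlineFunctionals.exists_intertwiningMap_character_of_line`); Frobenius reciprocity (existence form, ★
`F0P2pCmPrincipalSeriesInterface.exists_intertwiningMap_cmPrincipalSeries_ne_zero`) turns it into a non-zero `G`-map `A : i_G(χ) → i_G(wχ)` — print's standard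
intertwining operator up to a scalar.  Together with ★ socket #7 (`dim ≤ 1`, p855215): `Hom_G(i_G(χ), i_G(wχ)) = ℂ·A`.

* §1 `exists_intertwiningMap_weylConj_ne_zero` · `∃ A : i_G(χ) → i_G(wχ)`, `A ≠ 0` (regular `χ`, non-split `v`).
* §2 `intertwinerSpaceDimEqOne`               · over the socket's binders: `∃ A ≠ 0, ∀ A', ∃ c, ∀ x, A' x = c • A x` (§1 + ★ `intertwinerSpaceDimLeOne`).

WHAT IS NOT HERE.  The analytic realisation of `A` as the intertwining INTEGRAL `J(w, χ)` and its scalar `γ(χ)` (rows #4∕#5, seats K2E3-p04∕p05), `End_G(i_G(χ))`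
(row #8, seat K2E3-p08).

HONEST LABEL.  HC_CM is proved only modulo the 7 printed citations (2 remaining named inputs: hLiu418 = `stmt-HodgeConjecture-24832`, h413 =
`stmt-HodgeConjecture-24833`) until rung 0 closes; this file moves no counter.

## References
* [Casselman1995] W. Casselman, *Introduction to the theory of admissible representations of `p`-adic reductive groups* (draft 1 May 1995) —
  Thm. 3.2.4 (Frobenius), §6.4 Prop. 6.4.1 ∕ Thm. 6.4.1 pp. 62–64 (the operators `T_w`), L. 7.1.1 (a) p. 67.
* [BernsteinZelevinsky1977] I. N. Bernstein, A. V. Zelevinsky, Ann. Sci. ÉNS (4) 10 (1977) — Prop. 1.9 (b) p. 445, §2.12 Geometrical Lemma, Cor. 2.13 (c), Thm. 2.9.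
* [Keys1984] D. Keys, Compositio Math. 51 (1984) — §3 (intertwining operators `A(w, λ)`, Thms. 1–2).
* [Rogawski1990] J. D. Rogawski, Ann. of Math. Stud. 123 (1990) — §12.1 p. 171, §12.2 p. 173.
-/

set_option autoImplicit false
-- the mandated namespace repeats the single-problem summit's segment (`HodgeConjecture.HodgeConjecture`)
set_option linter.dupNamespace false

noncomputable section

open NumberField IsDedekindDomain MeasureTheory
open scoped Matrix MatrixGroups NNReal

open Literature.NumberTheory Literature.NumberTheory.Automorphic Literature.NumberTheory.Automorphic.UnitaryGroup
open Literature.NumberTheory.Rogawski1990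

namespace Summit.HodgeConjecture.HodgeConjecture.Cruxes.H413.K2E3IntertwinerSpaceDimEqOne

/-! ## §1 A non-zero intertwining map `i_G(χ) → i_G(wχ)` for regular `χ` -/

section CM

variable (L : Type) [Field L] [NumberField L] [IsCMField L] (v : HeightOneSpectrum (𝓞 ↥(maximalRealSubfield L)))

set_option synthInstance.maxHeartbeats 400000 in  -- HB: instance paths on the CM carrier `∏_{w ∣ v} L_w` (as the socket module)
set_option maxHeartbeats 3200000 in  -- HB (this decl only): two principal-series carriers (≈10⁷ nodes) matched against ★ N1, ★ eigen-line lemma and the ★ Frobenius interface; no `rw`∕`simp` on them; same measured class as ★ `K2E3IntertwinerSpaceDimLeOne` (RED 1.6M ∕ GREEN 2.4M there)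
/-- **A NON-ZERO INTERTWINING MAP `i_G(χ) → i_G(wχ)` EXISTS FOR REGULAR `χ`** (`G = U(Φ₃)(L⁺_v)`, `v` non-split, `χ = (χ₁, χ₂)` continuous,
`χ ≠ wχ = (χ̄₁⁻¹, χ₂)`): ★ N1 gives the `wχ`-line `ℓ ≤ r_B i_G(χ)` with quotient character `χ`; the torus is commutative (★ `torusU_mul_comm`), so
★ `exists_intertwiningMap_character_of_line` projects `r_B i_G(χ)` onto `ℓ ≅ ℂ_{wχ}` equivariantly and non-trivially; Frobenius (existence form, ★
`exists_intertwiningMap_cmPrincipalSeries_ne_zero` at `π = i_G(χ)`) lifts the functional to a non-zero `G`-map into `i_G(wχ)`.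
[cite: Casselman1995, §6.4 Prop. 6.4.1 p. 62; L. 7.1.1 (a) p. 67; Thm. 3.2.4] [cite: BernsteinZelevinsky1977, Prop. 1.9 (b) p. 445; §2.12, Cor. 2.13 (c)]
[cite: Keys1984, §3] [cite: Rogawski1990, §12.2 p. 173] -/
theorem exists_intertwiningMap_weylConj_ne_zero
    (hns : ∀ w : PlacesOver L v, IsCMField.complexConj L • w.1 = w.1)
    (χ₁ : (LocalRing L v)ˣ →* ℂˣ) (χ₂ : ↥(normOneUnits (conjLocal L (IsCMField.complexConj L) v)) →* ℂˣ)
    (h₁ : Continuous fun x => ((χ₁ x : ℂˣ) : ℂ)) (h₂ : Continuous fun x => ((χ₂ x : ℂˣ) : ℂ))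
    (hreg : cmTorusCharPair L v χ₁ χ₂ ≠ cmTorusCharPair L v (conjInvChar (conjLocal L (IsCMField.complexConj L) v) χ₁) χ₂) :
    ∃ A : (cmPrincipalSeries L 3 v (cmTorusCharPair L v χ₁ χ₂)).IntertwiningMap
        (cmPrincipalSeries L 3 v (cmTorusCharPair L v (conjInvChar (conjLocal L (IsCMField.complexConj L) v) χ₁) χ₂)), A ≠ 0 := by
  haveI := locallyCompactSpace_cmBorelU L 3 v
  -- ★ N1 at `χ`: the `wχ`-line `ℓ` (line character spelled `cmWeylTorusCharPair L v χ₁ χ₂`, which is `cmTorusCharPair L v (χ̄₁⁻¹) χ₂` by `rfl`)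
  have hN1 := (UnitaryGroup.U3PrincipalSeriesJacquetFiltration_iff L).1
    (F0P3U3PrincipalSeriesJacquetFiltrationHolds.U3PrincipalSeriesJacquetFiltration_holds L) v hns χ₁ χ₂ h₁ h₂
  obtain ⟨ℓ, hℓ1, hline, hquot⟩ := hN1.2.2
  -- the equivariant projection onto `ℓ ≅ ℂ_{wχ}` (commutative torus)
  obtain ⟨φ, hφ⟩ := F0P2pEigenlineFunctionals.exists_intertwiningMap_character_of_line (M := ↥(cmBorelTriple L 3 v).M)
    (UnitaryGroup.torusU_mul_comm _ _)
    ((cmPrincipalSeries L 3 v (cmTorusCharPair L v χ₁ χ₂)).normalizedJacquet (cmBorelTriple L 3 v))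
    (cmTorusCharPair L v (conjInvChar (conjLocal L (IsCMField.complexConj L) v) χ₁) χ₂) (cmTorusCharPair L v χ₁ χ₂)
    hreg.symm ℓ hℓ1 hline hquot
  -- Frobenius, existence form
  exact F0P2pCmPrincipalSeriesInterface.exists_intertwiningMap_cmPrincipalSeries_ne_zero L v
    (cmTorusCharPair L v (conjInvChar (conjLocal L (IsCMField.complexConj L) v) χ₁) χ₂)
    (cmPrincipalSeries L 3 v (cmTorusCharPair L v χ₁ χ₂)) (F0P2pCmPrincipalSeriesInterface.isSmooth_cmPrincipalSeries L v _) φ hφ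

end CM

/-! ## §2 `Hom_G(i_G(χ), i_G(wχ))` is exactly a line (over the socket's binders) -/

set_option synthInstance.maxHeartbeats 400000 in  -- HB: as §1
set_option maxHeartbeats 3200000 in  -- HB (this decl only): as §1 — the socket's binders (two principal-series carriers) are instantiated into §1 and into ★ socket #7
/-- **`Hom_G(i_G(χ), i_G(wχ)) = ℂ·A` WITH `A ≠ 0`, FOR REGULAR `χ`** — stated over the binders of socket #7 `sig_K2E3IntertwinerSpaceDimLeOne` (non-split `v`,
continuous `χ₁`, `χ₂`, `χ ≠ wχ`): there is a non-zero intertwining map `A : i_G(χ) → i_G(wχ)` (§1) and every `A'` is `c • A` (★ socket #7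
`K2E3IntertwinerSpaceDimLeOne.intertwinerSpaceDimLeOne`, p855215).  This is the shape rows #4∕#5 consume: «the» composition `i(χ) → i(wχ) → i(χ)` is
`B ∘ A` for the spanning pair, up to scalars.  [cite: Casselman1995, §6.4 Thm. 6.4.1 pp. 62–64; L. 7.1.1 (a) p. 67] [cite: BernsteinZelevinsky1977, Thm. 2.9; §2.12]
[cite: Keys1984, §3 Thms. 1–2] [cite: Rogawski1990, §12.2 p. 173] -/
theorem intertwinerSpaceDimEqOne :
  ∀ (L : Type) [Field L] [NumberField L] [IsCMField L] (v : HeightOneSpectrum (𝓞 ↥(maximalRealSubfield L))),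
    (∀ w : PlacesOver L v, IsCMField.complexConj L • w.1 = w.1) →
    ∀ (χ₁ : (UnitaryGroup.LocalRing L v)ˣ →* ℂˣ) (χ₂ : ↥(normOneUnits (conjLocal L (IsCMField.complexConj L) v)) →* ℂˣ), Continuous (fun x => ((χ₁ x : ℂˣ) : ℂ)) → Continuous (fun x => ((χ₂ x : ℂˣ) : ℂ)) → UnitaryGroup.cmTorusCharPair L v χ₁ χ₂ ≠ UnitaryGroup.cmTorusCharPair L v (UnitaryGroup.conjInvChar (conjLocal L (IsCMField.complexConj L) v) χ₁) χ₂ →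
      ∃ A : (UnitaryGroup.cmPrincipalSeries L 3 v (UnitaryGroup.cmTorusCharPair L v χ₁ χ₂)).IntertwiningMap (UnitaryGroup.cmPrincipalSeries L 3 v (UnitaryGroup.cmTorusCharPair L v (UnitaryGroup.conjInvChar (conjLocal L (IsCMField.complexConj L) v) χ₁) χ₂)),
        A ≠ 0 ∧ ∀ A' : (UnitaryGroup.cmPrincipalSeries L 3 v (UnitaryGroup.cmTorusCharPair L v χ₁ χ₂)).IntertwiningMap (UnitaryGroup.cmPrincipalSeries L 3 v (UnitaryGroup.cmTorusCharPair L v (UnitaryGroup.conjInvChar (conjLocal L (IsCMField.complexConj L) v) χ₁) χ₂)),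
          ∃ c : ℂ, ∀ x, A'.toLinearMap x = c • A.toLinearMap x := by
  intro L _ _ _ v hns χ₁ χ₂ h₁ h₂ hreg
  obtain ⟨A, hA⟩ := exists_intertwiningMap_weylConj_ne_zero L v hns χ₁ χ₂ h₁ h₂ hreg
  exact ⟨A, hA, fun A' => K2E3IntertwinerSpaceDimLeOne.intertwinerSpaceDimLeOne L v hns χ₁ χ₂ h₁ h₂ hreg A A' hA⟩

end Summit.HodgeConjecture.HodgeConjecture.Cruxes.H413.K2E3IntertwinerSpaceDimEqOne

end
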